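import Summits.Parity.GeneralizedHardyLittlewood.Theses.LiouvilleShiftedTables
import Summits.Parity.GeneralizedHardyLittlewood.Theorems.LiouvilleShiftedTablesDilatedTableChowlaQuarantineHarmonic
import Summits.Parity.GeneralizedHardyLittlewood.Theorems.LiouvilleShiftedTablesDilatedTableChowlaStubSmallConductors
import Summits.Parity.GeneralizedHardyLittlewood.Theorems.LiouvilleShiftedTablesDilatedTableChowlaStubFewBadConductors
import Summits.Parity.GeneralizedHardyLittlewood.Theorems.LiouvilleShiftedTablesDilatedTableChowlaStubOnePointTransfer
import Summits.Parity.GeneralizedHardyLittlewood.Theorems.LiouvilleShiftedTablesDilatedTableChowlaGenericCore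

/-!
# Siegel quarantine for `DilatedTableChowla` (stmt-Parity-14271), line `positivity-quarantine`

Support file for the crux `LiouvilleShiftedTables.DilatedTableChowla` (lead prover c1 of the line
`positivity-quarantine`).  It lands the line's COMPOSITION as a tree theorem:

* `pointwiseOffSparse_of_genericAffineTable` — the registered stub (C⁺) `GenericAffineTable`
  ("pointwise block bound `q⁴F ≤ x²/(log x)^C` off a harmonically sparse set of dilations, AT EVERY
  DILATION CARRYING ONE-POINT DATA", i.e. `(log x)^B`-saving character sums of `λ` to the moduli
  `q·m`, `m ≤ (log x)^κ`) implies the same statement WITHOUT the one-point hypothesis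
  (`Negative.PointwiseOffSparse`).  Proof = the quarantine architecture of the line, all inputs
  landed: (Z1) small conductors are Linnik-box zero-free (`SmallConductors.stub_smallConductors`,
  classical zero-free region + Siegel), (Z2) the bad conductors `≤ x` are multiples of `≤ (log x)^{E₀}`
  bad ones (`FewBadConductors.stub_fewBadConductors`, Bombieri's log-free density theorem), the GCD
  TRICK (`nonGeneric_subset`: a bad modulus `s ∣ q·m` localises to the divisor `s/gcd-part ∣ q` of
  size `> (log x)^{K−κ}`), hence the non-generic dilations have harmonic mass
  `≤ |S| (log x)^{2κ} (1 + log Q)/(log x)^K` (`nonGeneric_harmonic_le`) and join the exceptional set;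
  at generic dilations (★) `OnePointTransfer.stub_onePointTransfer` supplies the one-point data.
* `dilatedTableChowla_of_genericAffineTable` — hence (C⁺) implies the crux
  (`Negative.pointwiseOffSparse_imp_crux`), and with `GenericCore.genericAffineTable_of_dilatedTableChowla`
  the EQUIVALENCE `dilatedTableChowla_iff_genericAffineTable`.

Consequence for the item's why-might-fail ("an MR-type proof must exclude multiples of exceptional
`q₁ ≤ (log x)^{C+2}` via Siegel as BV does"): exceptional / Siegel moduli are provably NOT an
obstruction for X1 — any proof may assume Siegel–Walfisz-quality one-point data at every dilation it
treats.  All statements are in the crux's own vocabulary (no new definitions). [folklore]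
-/

noncomputable section

namespace Summit.Parity.GeneralizedHardyLittlewood.Theorems.DilatedTableChowla.Quarantine

open Finset
open scoped Classical
open Summit.Parity.GeneralizedHardyLittlewood.Theses.LiouvilleShiftedTables
open Summit.Parity.GeneralizedHardyLittlewood.Theorems.DilatedTableChowla.Negative

/-! ### §2 The quarantine: (C⁺) implies the pointwise-off-sparse form, hence the crux -/

/-- **(C⁺) ⟹ `PointwiseOffSparse`.**  The registered stub `GenericAffineTable` of the line
`positivity-quarantine` (written out: pointwise `q⁴F ≤ x²/(log x)^C` off a harmonically sparse `E'`
at every dilation `q ≤ x^{δ/2}` carrying `(log x)^B`-saving character sums of `λ` to the moduli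
`q·m ≤ q (log x)^κ`) implies the same bound with NO one-point hypothesis, off the enlarged sparse set
`E' ∪ {non-generic q}`: take (C⁺) at exponent `C+1`, (★) at its `B, κ` (giving the box `K', H`),
(Z2) at `θ = 1` (giving `E₀`, `S`), (Z1) at level `K = E₀ + 2κ + C + 3`; the non-generic dilations
have harmonic mass `≤ 2 (log x)^{-C-2}` (`nonGeneric_harmonic_le`, `1 + log Q ≤ 2 log x`), the
prover's `E'` has `≤ (log x)^{-C-1}`, total `≤ (log x)^{-C}` once `log x ≥ 2`; at a generic `q ∉ E'`
box-genericity ⟹ one-point data (★, `q ≤ x^{δ/2} ≤ x^{1/24}`) ⟹ `q⁴F ≤ x²/(log x)^{C+1}`. [folklore] -/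
theorem pointwiseOffSparse_of_genericAffineTable
    (hG : ∀ c : ℤ, c ≠ 0 → ∀ δ : ℝ, 0 < δ → δ ≤ 1 / 12 → ∀ C : ℝ, 0 < C → ∃ B κ : ℝ, 0 < κ ∧
      ∃ x₀ : ℝ, ∀ x : ℝ, x₀ ≤ x → ∀ A : ℝ, x ^ δ ≤ A → A ≤ x ^ (1 / 3 + δ) → ∀ u v : ℕ → ℕ,
        ∃ E' : Finset ℕ, (∑ q ∈ E', ((q : ℝ))⁻¹) ≤ (Real.log x ^ C)⁻¹ ∧
          ∀ q : ℕ, 1 ≤ q → q ≤ ⌊x ^ (δ / 2)⌋₊ → q ∉ E' →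
            (∀ n : ℕ, q ∣ n → (n : ℝ) ≤ q * Real.log x ^ κ → ∀ [NeZero n],
              ∀ χ : DirichletCharacter ℂ n, ∀ y : ℝ, x ^ (1 / 2 : ℝ) ≤ y → y ≤ x ^ 2 →
                ‖∑ k ∈ Finset.Icc 1 ⌊y⌋₊, (ArithmeticFunction.liouville k : ℂ) * χ (k : ZMod n)‖ ≤
                  y / Real.log x ^ B) →
            (q : ℝ) ^ 4 *
              (∑ a ∈ (Finset.Ioc ⌊A⌋₊ ⌊2 * A⌋₊).filter (fun a : ℕ => a ≡ u q [MOD q]),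
                ∑ a' ∈ (Finset.Ioc ⌊A⌋₊ ⌊2 * A⌋₊).filter (fun a' : ℕ => a' ≡ u q [MOD q]),
                  (∑ b ∈ (Finset.Icc 1 ⌊x / A⌋₊).filter (fun b : ℕ => b ≡ v q [MOD q]),
                    (ArithmeticFunction.liouville (Int.toNat ((a : ℤ) * b + c)) : ℝ) *
                      (ArithmeticFunction.liouville (Int.toNat ((a' : ℤ) * b + c)) : ℝ)) ^ 2)
              ≤ x ^ 2 / Real.log x ^ C) :
    PointwiseOffSparse := by
  intro c hc δ hδ hδ' C hC
  -- (C⁺) at exponent `C + 1`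
  obtain ⟨B, κ, hκ, x₁, hx₁⟩ := hG c hc δ hδ hδ' (C + 1) (by linarith)
  -- (★) for these `B, κ`: the Linnik box `K', H`
  obtain ⟨K', H, x₂, hx₂⟩ := OnePointTransfer.stub_onePointTransfer B κ hκ
  -- (Z2) with `θ = 1`
  obtain ⟨E₀, x₃, hx₃⟩ := FewBadConductors.stub_fewBadConductors 1 K' H
  -- (Z1) at level `K = E₀ + 2κ + C + 3`
  set K : ℝ := E₀ + 2 * κ + C + 3 with hKdef
  obtain ⟨x₄, hx₄⟩ := SmallConductors.stub_smallConductors K K' H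
  -- room: `(log x)^κ ≤ x^{1/2}` eventually
  obtain ⟨x₅, hx₅⟩ := eventually_log_rpow_le 1 κ (by norm_num : (0 : ℝ) < 1 / 2)
  refine ⟨max (max (max x₁ x₂) (max x₃ x₄)) (max x₅ (Real.exp 2)), fun x hx A hA1 hA2 u v => ?_⟩
  have hxx₁ : x₁ ≤ x := le_trans (le_trans (le_trans (le_max_left _ _) (le_max_left _ _))
    (le_max_left _ _)) hx
  have hxx₂ : x₂ ≤ x := le_trans (le_trans (le_trans (le_max_right _ _) (le_max_left _ _))
    (le_max_left _ _)) hx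
  have hxx₃ : x₃ ≤ x := le_trans (le_trans (le_trans (le_max_left _ _) (le_max_right _ _))
    (le_max_left _ _)) hx
  have hxx₄ : x₄ ≤ x := le_trans (le_trans (le_trans (le_max_right _ _) (le_max_right _ _))
    (le_max_left _ _)) hx
  have hxx₅ : x₅ ≤ x := le_trans (le_trans (le_max_left _ _) (le_max_right _ _)) hx
  have hxe : Real.exp 2 ≤ x := le_trans (le_trans (le_max_right _ _) (le_max_right _ _)) hx
  have hxpos : 0 < x := lt_of_lt_of_le (Real.exp_pos 2) hxe
  have hlog2 : 2 ≤ Real.log x := by rwa [Real.le_log_iff_exp_le hxpos]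
  have hx1 : 1 < x := by
    have : (1 : ℝ) < Real.exp 2 := by
      have := Real.add_one_le_exp (2 : ℝ); linarith
    linarith
  have hlogpos : 0 < Real.log x := by linarith
  set Q : ℕ := ⌊x ^ (δ / 2)⌋₊ with hQdef
  -- the Linnik box at `x`: `Good n` = no character mod `n` has a zero `z ≠ 1` in the box
  set Good : ℕ → Prop := fun n => ∀ [NeZero n], ∀ (χ : DirichletCharacter ℂ n) (z : ℂ),
      1 - K' * Real.log (Real.log x) / Real.log x < z.re → |z.im| ≤ Real.log x ^ H → z ≠ 1 →
        DirichletCharacter.LFunction χ z ≠ 0 with hGooddef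
  have hGood0 : Good 0 := by
    intro h; exact absurd rfl h.out
  -- (Z2) at `x`
  obtain ⟨S, hScard, hSbad', hScover'⟩ := hx₃ x hxx₃
  have hSbad : ∀ s ∈ S, ¬ Good s := by
    intro s hs hgood
    obtain ⟨hne, χ, z, h1, h2, h3, h4⟩ := hSbad' s hs
    exact (@hgood hne) χ z h1 h2 h3 h4
  have hScover : ∀ d : ℕ, 1 ≤ d → (d : ℝ) ≤ x ^ (1 : ℝ) → ¬ Good d → ∃ s ∈ S, s ∣ d := by
    intro d hd1 hdx hnot
    haveI : NeZero d := ⟨by omega⟩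
    by_contra hno
    apply hnot
    intro _ χ z h1 h2 h3 h4
    exact hno (hScover' d χ z hdx h1 h2 h3 h4)
  -- (Z1) at `x`
  have hsmall : ∀ d : ℕ, 1 ≤ d → (d : ℝ) ≤ Real.log x ^ K → Good d := by
    intro d hd1 hdK _ χ z h1 h2 h3
    exact hx₄ x hxx₄ d χ z hdK h1 h2 h3
  -- room: `Q (log x)^κ ≤ x^{1/24} x^{1/2} ≤ x`
  have hQx : (Q : ℝ) ≤ x ^ (δ / 2) := Nat.floor_le (Real.rpow_nonneg hxpos.le _)
  have hQ24 : (Q : ℝ) ≤ x ^ (1 / 24 : ℝ) :=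
    hQx.trans (Real.rpow_le_rpow_of_exponent_le hx1.le (by linarith))
  have hQroom : (Q : ℝ) * Real.log x ^ κ ≤ x ^ (1 : ℝ) := by
    have hk : Real.log x ^ κ ≤ x ^ (1 / 2 : ℝ) := by simpa using hx₅ x hxx₅
    calc (Q : ℝ) * Real.log x ^ κ ≤ x ^ (1 / 24 : ℝ) * x ^ (1 / 2 : ℝ) :=
          mul_le_mul hQ24 hk (Real.rpow_nonneg hlogpos.le κ) (Real.rpow_nonneg hxpos.le _)
      _ = x ^ ((1 / 24 : ℝ) + 1 / 2) := by rw [← Real.rpow_add hxpos]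
      _ ≤ x ^ (1 : ℝ) := Real.rpow_le_rpow_of_exponent_le hx1.le (by norm_num)
  -- the non-generic dilations and their harmonic mass
  set E : Finset ℕ := (Finset.Icc 1 Q).filter
    (fun q => ¬ ∀ n : ℕ, q ∣ n → (n : ℝ) ≤ q * Real.log x ^ κ → Good n) with hEdef
  have hEmass : ∑ q ∈ E, ((q : ℝ))⁻¹ ≤
      S.card * (Real.log x ^ κ) ^ 2 * (1 + Real.log Q) / Real.log x ^ K :=
    nonGeneric_harmonic_le hx1 hGood0 hSbad hScover hsmall hQroom
  -- (C⁺) at `x`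
  obtain ⟨E', hE', hpt⟩ := hx₁ x hxx₁ A hA1 hA2 u v
  refine ⟨E' ∪ E, ?_, fun q hq1 hqQ hqEE => ?_⟩
  · -- harmonic mass of `E' ∪ E`
    have hLC : 0 < Real.log x ^ C := Real.rpow_pos_of_pos hlogpos C
    have hLK : 0 < Real.log x ^ K := Real.rpow_pos_of_pos hlogpos K
    have hunion : ∑ q ∈ E' ∪ E, ((q : ℝ))⁻¹ ≤ ∑ q ∈ E', ((q : ℝ))⁻¹ + ∑ q ∈ E, ((q : ℝ))⁻¹ := by
      rw [← Finset.sum_union_inter]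
      have : 0 ≤ ∑ q ∈ E' ∩ E, ((q : ℝ))⁻¹ := Finset.sum_nonneg fun q _ => by positivity
      linarith
    -- `E'`: `(log x)^{-(C+1)} ≤ (log x)^{-C} / 2`
    have hE'le : ∑ q ∈ E', ((q : ℝ))⁻¹ ≤ (Real.log x ^ C)⁻¹ / 2 := by
      refine hE'.trans ?_
      rw [Real.rpow_add hlogpos C 1, Real.rpow_one, mul_inv, div_eq_mul_inv]
      exact mul_le_mul_of_nonneg_left (inv_anti₀ (by norm_num) hlog2) (inv_pos.2 hLC).le
    -- `E`: `|S| (log x)^{2κ} (1 + log Q) / (log x)^K ≤ 2 (log x)^{E₀ + 2κ + 1 - K} = 2 (log x)^{-C-2}`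
    have hEle : ∑ q ∈ E, ((q : ℝ))⁻¹ ≤ (Real.log x ^ C)⁻¹ / 2 := by
      refine hEmass.trans ?_
      have hlogQ : 1 + Real.log Q ≤ 2 * Real.log x := by
        have hQle : Real.log Q ≤ Real.log x := by
          rcases Nat.eq_zero_or_pos Q with hQ0 | hQpos
          · rw [hQ0, Nat.cast_zero, Real.log_zero]; exact hlogpos.le
          · refine Real.log_le_log (by exact_mod_cast hQpos) (hQx.trans ?_)
            calc x ^ (δ / 2) ≤ x ^ (1 : ℝ) := Real.rpow_le_rpow_of_exponent_le hx1.le (by linarith)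
              _ = x := Real.rpow_one x
        linarith
      have hk2 : (Real.log x ^ κ) ^ 2 = Real.log x ^ (2 * κ) := by
        rw [show (2 : ℝ) * κ = κ * 2 by ring, Real.rpow_mul hlogpos.le,
          show ((2 : ℝ)) = ((2 : ℕ) : ℝ) by norm_num, Real.rpow_natCast]
      have hKsplit : Real.log x ^ K =
          Real.log x ^ E₀ * Real.log x ^ (2 * κ) * Real.log x * (Real.log x ^ C * Real.log x ^ (2 : ℝ)) := by
        rw [hKdef, show E₀ + 2 * κ + C + 3 = E₀ + 2 * κ + 1 + (C + 2) by ring,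
          Real.rpow_add hlogpos, Real.rpow_add hlogpos, Real.rpow_add hlogpos, Real.rpow_one,
          Real.rpow_add hlogpos]
      have hL2 : (4 : ℝ) ≤ Real.log x ^ (2 : ℝ) := by
        rw [show ((2 : ℝ)) = ((2 : ℕ) : ℝ) by norm_num, Real.rpow_natCast]; nlinarith
      have hE0 : 0 < Real.log x ^ E₀ := Real.rpow_pos_of_pos hlogpos E₀
      have h2k : 0 < Real.log x ^ (2 * κ) := Real.rpow_pos_of_pos hlogpos _
      have hL2pos : 0 < Real.log x ^ (2 : ℝ) := Real.rpow_pos_of_pos hlogpos _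
      rw [hk2, hKsplit, div_le_iff₀ (by positivity)]
      -- |S| L^{2κ} (1 + log Q) ≤ (L^C)⁻¹/2 · (L^{E₀} L^{2κ} L (L^C L²))
      calc (S.card : ℝ) * Real.log x ^ (2 * κ) * (1 + Real.log Q)
          ≤ Real.log x ^ E₀ * Real.log x ^ (2 * κ) * (2 * Real.log x) := by
            gcongr
        _ = Real.log x ^ E₀ * Real.log x ^ (2 * κ) * Real.log x * 4 / 2 := by ring
        _ ≤ Real.log x ^ E₀ * Real.log x ^ (2 * κ) * Real.log x * Real.log x ^ (2 : ℝ) / 2 := by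
            gcongr
        _ = (Real.log x ^ C)⁻¹ / 2 *
              (Real.log x ^ E₀ * Real.log x ^ (2 * κ) * Real.log x *
                (Real.log x ^ C * Real.log x ^ (2 : ℝ))) := by
            field_simp
    linarith
  · -- pointwise bound at a generic dilation `q ∉ E'`
    have hqE' : q ∉ E' := fun h => hqEE (Finset.mem_union_left _ h)
    have hqE : q ∉ E := fun h => hqEE (Finset.mem_union_right _ h)
    have hgen : ∀ n : ℕ, q ∣ n → (n : ℝ) ≤ q * Real.log x ^ κ → Good n := by
      by_contra hng
      exact hqE (Finset.mem_filter.2 ⟨Finset.mem_Icc.2 ⟨hq1, hqQ⟩, hng⟩)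
    have hq24 : (q : ℝ) ≤ x ^ (1 / 24 : ℝ) := le_trans (by exact_mod_cast hqQ) hQ24
    -- (★): one-point data at `q`
    have hone : ∀ n : ℕ, q ∣ n → (n : ℝ) ≤ q * Real.log x ^ κ → ∀ [NeZero n],
        ∀ χ : DirichletCharacter ℂ n, ∀ y : ℝ, x ^ (1 / 2 : ℝ) ≤ y → y ≤ x ^ 2 →
          ‖∑ k ∈ Finset.Icc 1 ⌊y⌋₊, (ArithmeticFunction.liouville k : ℂ) * χ (k : ZMod n)‖ ≤
            y / Real.log x ^ B := by
      intro n hqn hnle _ χ y hy1 hy2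
      refine hx₂ x hxx₂ q hq1 hq24 (fun n' _ χ' z hqn' hn'le h1 h2 h3 => ?_) n χ y hqn hnle hy1 hy2
      exact hgen n' hqn' hn'le χ' z h1 h2 h3
    have hb := hpt q hq1 hqQ hqE' hone
    have hmono : x ^ 2 / Real.log x ^ (C + 1) ≤ x ^ 2 / Real.log x ^ C := by
      apply div_le_div_of_nonneg_left (by positivity) (Real.rpow_pos_of_pos hlogpos _)
      exact Real.rpow_le_rpow_of_exponent_le (by linarith) (by linarith)
    exact hb.trans hmono

/-- **(C⁺) ⟹ the crux.**  `GenericAffineTable → DilatedTableChowla`: the line's composition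
(`pointwiseOffSparse_of_genericAffineTable` + `Negative.pointwiseOffSparse_imp_crux`), with every
analytic input landed — Siegel/exceptional moduli are not an obstruction for X1. [folklore] -/
theorem dilatedTableChowla_of_genericAffineTable
    (hG : ∀ c : ℤ, c ≠ 0 → ∀ δ : ℝ, 0 < δ → δ ≤ 1 / 12 → ∀ C : ℝ, 0 < C → ∃ B κ : ℝ, 0 < κ ∧
      ∃ x₀ : ℝ, ∀ x : ℝ, x₀ ≤ x → ∀ A : ℝ, x ^ δ ≤ A → A ≤ x ^ (1 / 3 + δ) → ∀ u v : ℕ → ℕ,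
        ∃ E' : Finset ℕ, (∑ q ∈ E', ((q : ℝ))⁻¹) ≤ (Real.log x ^ C)⁻¹ ∧
          ∀ q : ℕ, 1 ≤ q → q ≤ ⌊x ^ (δ / 2)⌋₊ → q ∉ E' →
            (∀ n : ℕ, q ∣ n → (n : ℝ) ≤ q * Real.log x ^ κ → ∀ [NeZero n],
              ∀ χ : DirichletCharacter ℂ n, ∀ y : ℝ, x ^ (1 / 2 : ℝ) ≤ y → y ≤ x ^ 2 →
                ‖∑ k ∈ Finset.Icc 1 ⌊y⌋₊, (ArithmeticFunction.liouville k : ℂ) * χ (k : ZMod n)‖ ≤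
                  y / Real.log x ^ B) →
            (q : ℝ) ^ 4 *
              (∑ a ∈ (Finset.Ioc ⌊A⌋₊ ⌊2 * A⌋₊).filter (fun a : ℕ => a ≡ u q [MOD q]),
                ∑ a' ∈ (Finset.Ioc ⌊A⌋₊ ⌊2 * A⌋₊).filter (fun a' : ℕ => a' ≡ u q [MOD q]),
                  (∑ b ∈ (Finset.Icc 1 ⌊x / A⌋₊).filter (fun b : ℕ => b ≡ v q [MOD q]),
                    (ArithmeticFunction.liouville (Int.toNat ((a : ℤ) * b + c)) : ℝ) *
                      (ArithmeticFunction.liouville (Int.toNat ((a' : ℤ) * b + c)) : ℝ)) ^ 2)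
              ≤ x ^ 2 / Real.log x ^ C) :
    DilatedTableChowla :=
  pointwiseOffSparse_imp_crux (pointwiseOffSparse_of_genericAffineTable hG)

/-- **`DilatedTableChowla ↔ GenericAffineTable`** (the registered stub (C⁺) of the line
`positivity-quarantine` IS the crux): `→` is `GenericCore.genericAffineTable_of_dilatedTableChowla`
(Markov; the one-point hypothesis unused), `←` is `dilatedTableChowla_of_genericAffineTable`
(the quarantine). [folklore] -/
theorem dilatedTableChowla_iff_genericAffineTable :
    DilatedTableChowla ↔
    ∀ c : ℤ, c ≠ 0 → ∀ δ : ℝ, 0 < δ → δ ≤ 1 / 12 → ∀ C : ℝ, 0 < C → ∃ B κ : ℝ, 0 < κ ∧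
      ∃ x₀ : ℝ, ∀ x : ℝ, x₀ ≤ x → ∀ A : ℝ, x ^ δ ≤ A → A ≤ x ^ (1 / 3 + δ) → ∀ u v : ℕ → ℕ,
        ∃ E' : Finset ℕ, (∑ q ∈ E', ((q : ℝ))⁻¹) ≤ (Real.log x ^ C)⁻¹ ∧
          ∀ q : ℕ, 1 ≤ q → q ≤ ⌊x ^ (δ / 2)⌋₊ → q ∉ E' →
            (∀ n : ℕ, q ∣ n → (n : ℝ) ≤ q * Real.log x ^ κ → ∀ [NeZero n],
              ∀ χ : DirichletCharacter ℂ n, ∀ y : ℝ, x ^ (1 / 2 : ℝ) ≤ y → y ≤ x ^ 2 →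
                ‖∑ k ∈ Finset.Icc 1 ⌊y⌋₊, (ArithmeticFunction.liouville k : ℂ) * χ (k : ZMod n)‖ ≤
                  y / Real.log x ^ B) →
            (q : ℝ) ^ 4 *
              (∑ a ∈ (Finset.Ioc ⌊A⌋₊ ⌊2 * A⌋₊).filter (fun a : ℕ => a ≡ u q [MOD q]),
                ∑ a' ∈ (Finset.Ioc ⌊A⌋₊ ⌊2 * A⌋₊).filter (fun a' : ℕ => a' ≡ u q [MOD q]),
                  (∑ b ∈ (Finset.Icc 1 ⌊x / A⌋₊).filter (fun b : ℕ => b ≡ v q [MOD q]),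
                    (ArithmeticFunction.liouville (Int.toNat ((a : ℤ) * b + c)) : ℝ) *
                      (ArithmeticFunction.liouville (Int.toNat ((a' : ℤ) * b + c)) : ℝ)) ^ 2)
              ≤ x ^ 2 / Real.log x ^ C :=
  ⟨GenericCore.genericAffineTable_of_dilatedTableChowla, dilatedTableChowla_of_genericAffineTable⟩

end Summit.Parity.GeneralizedHardyLittlewood.Theorems.DilatedTableChowla.Quarantine

end
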